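import Summits.HodgeConjecture.HodgeConjecture.Theorems.CurveNetMordellWeilVerticalSupportMiddleChowDegenerate
import Summits.HodgeConjecture.HodgeConjecture.Theorems.CurveNetMordellWeilVerticalSupportMiddleIffHodge
import Literature.AlgebraicGeometry.HodgeTheory.TopHodgeClassesSpannedByPullbacksFact
import Literature.AlgebraicGeometry.HodgeTheory.HolomorphicBundleChernCharacterTopDegree
import Literature.AlgebraicGeometry.HodgeTheory.ChernCharacterClass
import Literature.AlgebraicGeometry.HodgeTheory.HodgeTypePullbackVanishing
import Literature.AlgebraicGeometry.HodgeTheory.HardLefschetzNFoldHolds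
import Literature.AlgebraicGeometry.HodgeTheory.HyperplaneClassLine
import Literature.AlgebraicGeometry.Motives.ProjectiveNoetherNormalization
import Literature.AlgebraicGeometry.Motives.SegreHyperplaneClass
import Literature.Geometry.Kaehler.ChernCharacterPullback
import Literature.AlgebraicGeometry.HodgeTheory.ChernCharacterTautologicalPullback
import Literature.AlgebraicGeometry.HodgeTheory.ComplexOrientationDegreeFormulaReduction
import Literature.NumberTheory.Transcendental.AnalytificationConnected
import Literature.AlgebraicGeometry.Morphisms.IsoOverOpen
import Literature.AlgebraicGeometry.HodgeTheory.DegreeFormulaBookkeeping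
import Literature.AlgebraicGeometry.Motives.GenericFinitenessOfDegree
import Literature.AlgebraicGeometry.HodgeTheory.GenericEtalenessOfDegree
import Literature.AlgebraicGeometry.Resolution.ResolveRationalMapSmoothProjective
import Literature.AlgebraicGeometry.HodgeTheory.FiniteFlatRankOfDegree
import Literature.AlgebraicGeometry.Motives.FiniteEtaleFibreComplexPoints
import Literature.AlgebraicGeometry.HodgeTheory.ChernCharacterTautologicalLinEquiv
import Literature.AlgebraicGeometry.Motives.SmoothProjectiveNoetherLinEquiv
import Literature.AlgebraicGeometry.HodgeTheory.TopHodgeClassesSpannedByPullbacksOfInputs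
import Literature.AlgebraicGeometry.HodgeTheory.LefschetzOneOneCartierDivisor
import Literature.AlgebraicGeometry.HodgeTheory.TautologicalBundleSegre
import Literature.AlgebraicGeometry.Motives.CartierDivisorEffective
import Literature.AlgebraicGeometry.Motives.EffectiveCartierSerreA
import Literature.AlgebraicGeometry.HodgeTheory.LefschetzOneOneEmbeddingCurrency

/-!
# Skeleton — crux stmt-HodgeConjecture-2782 `VerticalSupportMiddle`, line `regime-split-middle-step`
(lead c2 reshape of lead c1's final skeleton, 2026-08-17 — stubs aligned to the tree's NAMED DEBTS; namespace per protocol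
`Summit.HodgeConjecture.HodgeConjecture.Cruxes.VerticalSupportMiddle.RegimeSplitMiddleStep`)

STATE OF THE LINE (everything named below is LANDED in `Summits/HodgeConjecture/HodgeConjecture/Theorems/`):

* `CurveNetMordellWeilDefs` — `RegimeSplit.HodgeBelowDim`, `ChowZeroDegenerate`, `MiddleStepFor`.
* `CurveNetMordellWeilVerticalSupportMiddleReduction` — the level-wise reduction `hodgeConjecture_of_middleStep`
  (HC ⟸ ∀ q ≥ 2, HC(dims < 2q) ⟹ HC^q(2q-folds)), descent `supportedHodgeClasses_algebraic_of_hodgeBelowDim`,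
  the split glue `verticalSupportMiddle_of_regimes`, `hodgeBelowDim_four`, the second provable regime
  `middleStepFor_chowRankLEOne_of_gysin`.
* `CurveNetMordellWeilVerticalSupportMiddleChowDegenerate` — strategist stub 2 PROVED granted a Gysin /
  cycle-class formalism with Hodge-compatible Gysin morphisms: `middleStepChowDegenerate_of_gysin`
  (= registered `stub_chowDegenerateRegime_of_gysin`), and its trust base
  `middleStepChowDegenerate_of_complexOrientationFacts (hB) (hC)`.
* `CurveNetMordellWeilVerticalSupportMiddleIffHodge` — `verticalSupportMiddle_iff_hodgeConjecture`:
  **the crux AS TYPED ⟺ the Hodge conjecture, unconditionally**; `verticalSupportMiddle_iff_regimes`: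
  crux ⟺ heart ∧ CH₀-degenerate regime (so the heart is NECESSARY).
* strategist stub 1 is the tree's theorem `BlochSrinivas1983_decompositionOfTheDiagonal_holds`.

OPEN STUBS (exactly the honest residual, each now a CATALOGUED statement of the tree):
* (wave 3) `stub_degreeFormula_h4a/h4b/h5pre/h5geom/h5deg` ⟹ `degreeFormula_of_stubs : Fulton1998_degreeFormula_complexOrientation` (Fulton, Lemma 19.1.2 for the complex
  orientations; named fact CLAIMED by seat prover-pitem-stmt-HodgeConjecture-3003-c6-0 — approach: the two residual
  hypotheses `h4` (general fibres) / `h5` (resolving `τ⁻¹ ∘ g`) of `Fulton1998_degreeFormula_complexOrientation_of`;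
  not duplicated by this lead);
* the spanning fact `topHodgeClasses_spanned_by_pullbacks` (named debt, CLAIMED by this lead), CUT into six sub-stubs
  `stub_chernCharacter_tautological_pullback` (A), `stub_chernCharacter_of_linEquiv` (C), `stub_noether_linEquiv` (E1),
  `stub_chernCharacter_tautological_segre` (P1), `stub_lefschetzOneOne_tautological` (G4, the lead's),
  `stub_spanningAssembly` (the lead's), composed in `topHodgeClassesSpannedByPullbacks_of_stubs`; with the degree
  formula it gives Voisin II Lemma 9.18 (`Voisin2003_cycleClass_div_eq_zero_complexOrientation_of_degreeFormula_of_spanning`);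
* `stub_middleStepHeartland` : `MiddleStepFor fun X ↦ ¬ ChowZeroDegenerate X` — THE HEART = the Hodge conjecture
  for CH₀-non-degenerate `2q`-folds given HC below; by `verticalSupportMiddle_iff_regimes` and
  `verticalSupportMiddle_iff_hodgeConjecture` it is NECESSARY for the crux and equivalent to HC modulo the
  CH₀-degenerate regime, i.e. modulo the two literature facts: summit-sized BY THEOREM (lead c1: `promote-stub`).
-/

noncomputable section

set_option linter.dupNamespace false

open CategoryTheory AlgebraicGeometry Order Set
open Literature.AlgebraicGeometry.Motives (primeCycle)
open Literature.AlgebraicGeometry Literature.AlgebraicGeometry.HodgeTheory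
open Literature.AlgebraicTopology.SingularHomology Literature.Geometry.Kaehler
open Summit.HodgeConjecture.HodgeConjecture.Theorems
open Summit.HodgeConjecture.HodgeConjecture.Theorems.RegimeSplit

namespace Summit.HodgeConjecture.HodgeConjecture.Cruxes.VerticalSupportMiddle.RegimeSplitMiddleStep

/-! ### Closed stubs (landed) -/

/-- Strategist stub 1 — the decomposition of the diagonal — is a theorem of the tree. [cite: VoisinHodgeII2003, Cor. 10.21] -/
theorem decompositionOfTheDiagonal :
    Literature.Barriers.HodgeConjecture.BlochSrinivas1983_decompositionOfTheDiagonal :=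
  Literature.Barriers.HodgeConjecture.BlochSrinivas1983_decompositionOfTheDiagonal_holds

/-- Stub 2 — the CH₀-degenerate regime granted `(G, hG)` — is LANDED (`middleStepChowDegenerate_of_gysin`).
[cite: VoisinHodgeII2003, Prop. 10.26] -/
theorem chowDegenerateRegime_of_gysin :
    ∀ (G : GysinFormalism), G.IsGysinHodgeCompatible → MiddleStepFor ChowZeroDegenerate :=
  middleStepChowDegenerate_of_gysin

/-! ### The registered open stubs -/

/-! #### The degree formula, cut into sub-stubs (lead c2, wave 3)

`Fulton1998_degreeFormula_complexOrientation` = `Fulton1998_degreeFormula_complexOrientation_of h4 h5` (tree: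
`ComplexOrientationDegreeFormulaReduction`, the topological half being PROVED). The two residual statements of
algebraic geometry are cut further:
* `h4` (general fibres of a degree-`k` morphism `q : T ⟶ W` of smooth projective `d`-folds have `k` complex points)
  = `stub_degreeFormula_h4aF` (generic finiteness) + `stub_degreeFormula_h4aE` (generic étaleness, EGA IV 17.6.1 at the generic
  fibre) + `stub_degreeFormula_h4aR` (rank = `[K(T):K(W)] = k` over the finite flat locus), glued by `degreeFormula_h4a_of_stubs` into a
  non-empty open `U ⊆ V` over which `q` is finite étale of constant rank `k`
  + `stub_degreeFormula_h4b` (over such a `U`, the fibre of a complex point has exactly `k` complex points: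
  base change to `Spec ℂ`, a finite étale `ℂ`-algebra of dimension `k` has `k` points) + a complex point in `U`
  (`ComplexPoints.exists_pt_mem`, glue `degreeFormula_h4_of_stubs`);
* `h5` (resolving the rational map `τ⁻¹ ∘ g : V ⇢ W`) = `stub_degreeFormula_h5pre` (bookkeeping: `g η = z = τ ω` and
  `κ(z) → κ(ω)` surjective, from the cycle equations) + `stub_degreeFormula_h5geom` (the geometry: a smooth projective
  `T` with `p : T ⟶ V` birational and `q : T ⟶ W`, `p ≫ g = q ≫ τ` — the join of the projective model `V` of `K(V)`
  with the `K(V)`-point `Spec K(V) → Spec κ(ω) → W` inside `V ×_X W` (`ProjModel`, `exists_join` pattern,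
  `Hom.isBirational`), then Hironaka `exists_isSmoothProjective_isBirational_of_isProjectiveOver`)
  + `stub_degreeFormula_h5deg` (bookkeeping: `dim T = d`, `q` dominant and `q_*[T] = k • [W]` from
  `τ_* q_* [T] = g_* p_* [T] = k • [Z]`, `algebraicCycleMap_comp`, `algebraicCycleMap_primeCycle_eq_nsmul`,
  `eq_genericPoint_of_height_eq`), glue `degreeFormula_h5_of_stubs`. -/

/-- SUB-STUB h4aF (wave 3): **generic finiteness of a degree-`k` morphism.** For `q : T ⟶ W` between smooth projective
`d`-folds with `q_*[T] = k • [W]` (`k ≥ 1`), `q` is finite over an open neighbourhood of the generic point of `W` (the generic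
fibre is the single point `η_T`; Stacks 02UP). [cite: Harris1992, Prop. 7.16] [cite: StacksProject, Tag 02UP] -/
theorem stub_degreeFormula_h4aF :
    ∀ ⦃d : ℕ⦄ ⦃T W : Motives.SchemeOver ℂ⦄ (hT : Motives.IsSmoothProjective d T)
      (hW : Motives.IsSmoothProjective d W) (q : T ⟶ W) [QuasiCompact q.left] ⦃θ : T.left⦄ ⦃ω : W.left⦄,
      IsGenericPoint θ Set.univ → IsGenericPoint ω Set.univ → ∀ ⦃k : ℕ⦄, 0 < k →
      AlgebraicCycle.map q.left Order.height Order.height (Motives.primeCycle θ) = k • Motives.primeCycle ω →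
      ∃ U : W.left.Opens, ω ∈ U ∧ IsFinite (q.left ∣_ U) :=
  Motives.exists_isFinite_morphismRestrict_of_map_primeCycle_eq_nsmul

/-- SUB-STUB h4aE (wave 3): **generic étaleness of a degree-`k` morphism in characteristic `0`.** For `q : T ⟶ W` between
smooth projective `d`-folds over `ℂ` with `q_*[T] = k • [W]` (`k ≥ 1`), `q` is étale over an open neighbourhood of the generic point
of `W` (`K(T)/K(W)` is finite separable, EGA IV 17.6.1 at `η_T`, and `q` is closed). [cite: Grothendieck1967, Thm. 17.6.1]
[cite: Harris1992, Prop. 7.16] -/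
theorem stub_degreeFormula_h4aE :
    ∀ ⦃d : ℕ⦄ ⦃T W : Motives.SchemeOver ℂ⦄ (hT : Motives.IsSmoothProjective d T)
      (hW : Motives.IsSmoothProjective d W) (q : T ⟶ W) [QuasiCompact q.left] ⦃θ : T.left⦄ ⦃ω : W.left⦄,
      IsGenericPoint θ Set.univ → IsGenericPoint ω Set.univ → ∀ ⦃k : ℕ⦄, 0 < k →
      AlgebraicCycle.map q.left Order.height Order.height (Motives.primeCycle θ) = k • Motives.primeCycle ω →
      ∃ U : W.left.Opens, ω ∈ U ∧ Etale (q.left ∣_ U) :=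
  exists_etale_morphismRestrict_of_map_primeCycle_eq_nsmul

/-- SUB-STUB h4aR (wave 3): **the rank of a degree-`k` morphism over its finite flat locus is `k`.** For `q : T ⟶ W` between
smooth projective `d`-folds with `q_*[T] = k • [W]` (`k ≥ 1`) and an open `U ∋ η_W` over which `q` is finite and flat, the rank
of `q_* 𝒪_T` is `k` at every point of `U` (locally constant on the irreducible `U`, and `= [K(T):K(W)] = k` at `η_W`).
[cite: Fulton1998, Example 1.7.4] [cite: StacksProject, Tag 02KA] -/
theorem stub_degreeFormula_h4aR :
    ∀ ⦃d : ℕ⦄ ⦃T W : Motives.SchemeOver ℂ⦄ (hT : Motives.IsSmoothProjective d T)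
      (hW : Motives.IsSmoothProjective d W) (q : T ⟶ W) [QuasiCompact q.left] ⦃θ : T.left⦄ ⦃ω : W.left⦄,
      IsGenericPoint θ Set.univ → IsGenericPoint ω Set.univ → ∀ ⦃k : ℕ⦄, 0 < k →
      AlgebraicCycle.map q.left Order.height Order.height (Motives.primeCycle θ) = k • Motives.primeCycle ω →
      ∀ (U : W.left.Opens), ω ∈ U → ∀ [IsFinite (q.left ∣_ U)] [Flat (q.left ∣_ U)],
        ∀ u : ↥U, (q.left ∣_ U).finrank u = k :=
  finrank_morphismRestrict_eq_of_map_primeCycle_eq_nsmul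

/-- Glue (former sub-stub h4a): **the finite étale locus of a degree-`k` morphism**, from h4aF, h4aE, h4aR — intersect the
three opens with `V` (all contain the generic point) and restrict (`IsFinite`, `Etale` are local on the target).
[cite: Harris1992, Prop. 7.16] -/
theorem degreeFormula_h4a_of_stubs :
    ∀ ⦃d : ℕ⦄ ⦃T W : Motives.SchemeOver ℂ⦄ (hT : Motives.IsSmoothProjective d T)
      (hW : Motives.IsSmoothProjective d W) (q : T ⟶ W) [QuasiCompact q.left] ⦃θ : T.left⦄ ⦃ω : W.left⦄,
      IsGenericPoint θ Set.univ → IsGenericPoint ω Set.univ → ∀ ⦃k : ℕ⦄, 0 < k →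
      AlgebraicCycle.map q.left Order.height Order.height (Motives.primeCycle θ) = k • Motives.primeCycle ω →
      ∀ V : W.left.Opens, (V : Set W.left).Nonempty →
        ∃ U : W.left.Opens, (U : Set W.left).Nonempty ∧ U ≤ V ∧
          IsFinite (q.left ∣_ U) ∧ Flat (q.left ∣_ U) ∧ Etale (q.left ∣_ U) ∧
          ∀ u : ↥U, (q.left ∣_ U).finrank u = k := by
  intro d T W hT hW q _ θ ω hθ hω k hk hq V hV
  obtain ⟨U₁, hω₁, hfin⟩ := stub_degreeFormula_h4aF hT hW q hθ hω hk hq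
  obtain ⟨U₂, hω₂, het⟩ := stub_degreeFormula_h4aE hT hW q hθ hω hk hq
  -- the generic point lies in every non-empty open
  have hωV : ω ∈ V := (hω.mem_open_set_iff V.isOpen).mpr (by simpa using hV)
  let U : W.left.Opens := V ⊓ U₁ ⊓ U₂
  have hωU : ω ∈ U := ⟨⟨hωV, hω₁⟩, hω₂⟩
  haveI : IsFinite (q.left ∣_ U) :=
    Literature.AlgebraicGeometry.Morphisms.of_morphismRestrict_of_le @IsFinite q.left
      (show U ≤ U₁ from inf_le_left.trans inf_le_right) hfin
  haveI : Etale (q.left ∣_ U) :=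
    Literature.AlgebraicGeometry.Morphisms.of_morphismRestrict_of_le @Etale q.left (show U ≤ U₂ from inf_le_right) het
  haveI : Flat (q.left ∣_ U) := ((Etale.iff_flat_and_formallyUnramified).mp inferInstance).1
  exact ⟨U, ⟨ω, hωU⟩, inf_le_left.trans inf_le_left, inferInstance, inferInstance, inferInstance,
    stub_degreeFormula_h4aR hT hW q hθ hω hk hq U hωU⟩

/-- SUB-STUB h4b (wave 3): **complex points of a fibre of a finite étale cover of rank `k`.** Over an open `U ⊆ W`
where `q : T ⟶ W` is finite étale of constant rank `k`, the fibre of every complex point `b ∈ U(ℂ)`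
consists of exactly `k` complex points of `T`. [cite: Harris1992, Prop. 7.16] -/
theorem stub_degreeFormula_h4b :
    ∀ ⦃d : ℕ⦄ ⦃T W : Motives.SchemeOver ℂ⦄ (hT : Motives.IsSmoothProjective d T)
      (hW : Motives.IsSmoothProjective d W) (q : T ⟶ W) (U : W.left.Opens) [IsFinite (q.left ∣_ U)]
      [Flat (q.left ∣_ U)] [Etale (q.left ∣_ U)] ⦃k : ℕ⦄, (∀ u : ↥U, (q.left ∣_ U).finrank u = k) →
      ∀ b : Motives.ComplexPoints W, b.pt ∈ U →
        ∃ v : Fin k → Motives.ComplexPoints T, Function.Injective v ∧ (Motives.AlgPoints.map q) ⁻¹' {b} = Set.range v :=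
  Motives.exists_fin_complexPoints_fibre_of_finite_etale_finrank_eq

/-- (former sub-stub h5pre, PROVED by the lead, LANDED p147466 `Literature/AlgebraicGeometry/HodgeTheory/DegreeFormulaBookkeeping.lean`): **bookkeeping of the cycle equations.** `g_*[V] = k • [Z]` (`k ≥ 1`) and
`τ_*[W] = [Z]` force `g η = z = τ ω` and `κ(z) → κ(ω)` surjective (residue degree `1`). [cite: Fulton1998, §1.4] -/
theorem stub_degreeFormula_h5pre :
    ∀ ⦃n d : ℕ⦄ ⦃X V W : Motives.SchemeOver ℂ⦄ (hX : Motives.IsSmoothProjective n X)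
      (hV : Motives.IsSmoothProjective d V) (hW : Motives.IsSmoothProjective d W)
      (g : V ⟶ X) (τ : W ⟶ X) [QuasiCompact g.left] [QuasiCompact τ.left] ⦃η : V.left⦄ ⦃ω : W.left⦄,
      IsGenericPoint η Set.univ → IsGenericPoint ω Set.univ → ∀ ⦃z : X.left⦄ ⦃k : ℕ⦄, 0 < k →
      AlgebraicCycle.map g.left Order.height Order.height (Motives.primeCycle η) = k • Motives.primeCycle z →
      AlgebraicCycle.map τ.left Order.height Order.height (Motives.primeCycle ω) = Motives.primeCycle z →
      g.left.base η = z ∧ τ.left.base ω = z ∧ Function.Surjective (τ.left.residueFieldMap ω) :=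
  base_eq_and_residueFieldMap_surjective_of_map_primeCycle

/-- SUB-STUB h5geom (wave 3): **resolving the rational map `τ⁻¹ ∘ g` by a smooth projective model.** For smooth
projective `V`, `W` (`d`-folds) over the smooth projective `X`, `g : V ⟶ X`, `τ : W ⟶ X` with `g η_V = τ η_W` and
`κ(τ η_W) → κ(η_W)` surjective (i.e. `τ` birational onto the common image), there are a smooth projective `T` and
`p : T ⟶ V` birational, `q : T ⟶ W` with `p ≫ g = q ≫ τ`: the join of the projective model `V` of `K(V)` with the
`K(V)`-point `Spec K(V) → Spec κ(η_W) → W` in `V ×_X W`, resolved by Hironaka. [cite: Hartshorne1977, II Example 7.17.3]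
[cite: Hironaka1964, Main Theorem I] [cite: ZariskiSamuel1960, Ch. VI §17] -/
theorem stub_degreeFormula_h5geom :
    ∀ ⦃n d : ℕ⦄ ⦃X V W : Motives.SchemeOver ℂ⦄ (hX : Motives.IsSmoothProjective n X)
      (hV : Motives.IsSmoothProjective d V) (hW : Motives.IsSmoothProjective d W)
      (g : V ⟶ X) (τ : W ⟶ X) ⦃η : V.left⦄ ⦃ω : W.left⦄,
      IsGenericPoint η Set.univ → IsGenericPoint ω Set.univ →
      g.left.base η = τ.left.base ω → Function.Surjective (τ.left.residueFieldMap ω) →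
      ∃ (T : Motives.SchemeOver ℂ) (d' : ℕ) (_ : Motives.IsSmoothProjective d' T) (p : T ⟶ V) (q : T ⟶ W),
        p ≫ g = q ≫ τ ∧ Resolution.IsBirational p.left :=
  Resolution.exists_isSmoothProjective_isBirational_comp_eq_of_residueFieldMap_surjective

/-- (former sub-stub h5deg, PROVED by the lead, LANDED p147466 `Literature/AlgebraicGeometry/HodgeTheory/DegreeFormulaBookkeeping.lean`): **degree bookkeeping on the resolved square.** If `p ≫ g = q ≫ τ` with `p`
birational, `g_*[V] = k • [Z]`, `τ_*[W] = [Z]`, then `dim T = dim V`, `q` is dominant and `q_*[T] = k • [W]`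
(`τ_* q_*[T] = g_* p_*[T] = k • [Z]`, functoriality of proper push-forward, Stacks 02R5). [cite: Fulton1998, §1.4] -/
theorem stub_degreeFormula_h5deg :
    ∀ ⦃n d d' e : ℕ⦄ ⦃X V W T : Motives.SchemeOver ℂ⦄ (hX : Motives.IsSmoothProjective n X)
      (hV : Motives.IsSmoothProjective d V) (hW : Motives.IsSmoothProjective d W) (hT : Motives.IsSmoothProjective d' T)
      (_hde : d + e = n) (g : V ⟶ X) (τ : W ⟶ X) (p : T ⟶ V) (q : T ⟶ W) [QuasiCompact g.left] [QuasiCompact τ.left]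
      ⦃η : V.left⦄ ⦃ω : W.left⦄, IsGenericPoint η Set.univ → IsGenericPoint ω Set.univ → ∀ ⦃z : X.left⦄ ⦃k : ℕ⦄, 0 < k →
      AlgebraicCycle.map g.left Order.height Order.height (Motives.primeCycle η) = k • Motives.primeCycle z →
      AlgebraicCycle.map τ.left Order.height Order.height (Motives.primeCycle ω) = Motives.primeCycle z →
      p ≫ g = q ≫ τ → Resolution.IsBirational p.left →
      ∃ (T : Motives.SchemeOver ℂ) (_ : Motives.IsSmoothProjective d T) (p : T ⟶ V) (q : T ⟶ W)
        (_ : QuasiCompact q.left) (θ : T.left), IsGenericPoint θ Set.univ ∧ p ≫ g = q ≫ τ ∧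
        Resolution.IsBirational p.left ∧
        AlgebraicCycle.map q.left Order.height Order.height (Motives.primeCycle θ) = k • Motives.primeCycle ω :=
  exists_resolution_of_degree_eq_of_comp_eq

/-- Glue: hypothesis `h4` of `Fulton1998_degreeFormula_complexOrientation_of` from `h4a`, `h4b` and a complex point in
the finite étale locus. [cite: Harris1992, Prop. 7.16] -/
theorem degreeFormula_h4_of_stubs :
    ∀ ⦃d : ℕ⦄ ⦃T W : Motives.SchemeOver ℂ⦄ (hT : Motives.IsSmoothProjective d T)
      (hW : Motives.IsSmoothProjective d W) (q : T ⟶ W) [QuasiCompact q.left] ⦃θ : T.left⦄ ⦃ω : W.left⦄,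
      IsGenericPoint θ Set.univ → IsGenericPoint ω Set.univ → ∀ ⦃k : ℕ⦄, 0 < k →
      AlgebraicCycle.map q.left Order.height Order.height (Motives.primeCycle θ) = k • Motives.primeCycle ω →
      ∀ V : W.left.Opens, (V : Set W.left).Nonempty →
        ∃ b : Motives.ComplexPoints W, b.pt ∈ V ∧ ∃ v : Fin k → Motives.ComplexPoints T,
          Function.Injective v ∧ (Motives.AlgPoints.map q) ⁻¹' {b} = Set.range v := by
  intro d T W hT hW q _ θ ω hθ hω k hk hq V hV
  obtain ⟨U, hUne, hUV, hfin, hflat, hsm, hrank⟩ := degreeFormula_h4a_of_stubs hT hW q hθ hω hk hq V hV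
  haveI := hfin
  haveI := hflat
  haveI := hsm
  haveI := hW.smoothOfRelativeDimension
  haveI : LocallyOfFiniteType W.hom := by
    haveI : Smooth W.hom := SmoothOfRelativeDimension.smooth d _
    infer_instance
  obtain ⟨b, hb⟩ := Motives.ComplexPoints.exists_pt_mem (X := W) hUne U.isOpen.isLocallyClosed
  obtain ⟨v, hv, hfib⟩ := stub_degreeFormula_h4b hT hW q U hrank b hb
  exact ⟨b, hUV hb, v, hv, hfib⟩

/-- Glue: hypothesis `h5` of `Fulton1998_degreeFormula_complexOrientation_of` from `h5pre`, `h5geom`, `h5deg`.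
[cite: Hartshorne1977, II Example 7.17.3] -/
theorem degreeFormula_h5_of_stubs :
    ∀ ⦃n d e : ℕ⦄ ⦃X V W : Motives.SchemeOver ℂ⦄ (hX : Motives.IsSmoothProjective n X)
      (hV : Motives.IsSmoothProjective d V) (hW : Motives.IsSmoothProjective d W) (_hde : d + e = n)
      (g : V ⟶ X) (τ : W ⟶ X) [QuasiCompact g.left] [QuasiCompact τ.left] ⦃η : V.left⦄ ⦃ω : W.left⦄,
      IsGenericPoint η Set.univ → IsGenericPoint ω Set.univ → ∀ ⦃z : X.left⦄ ⦃k : ℕ⦄, 0 < k →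
      AlgebraicCycle.map g.left Order.height Order.height (Motives.primeCycle η) = k • Motives.primeCycle z →
      AlgebraicCycle.map τ.left Order.height Order.height (Motives.primeCycle ω) = Motives.primeCycle z →
      ∃ (T : Motives.SchemeOver ℂ) (_ : Motives.IsSmoothProjective d T) (p : T ⟶ V) (q : T ⟶ W)
        (_ : QuasiCompact q.left) (θ : T.left), IsGenericPoint θ Set.univ ∧ p ≫ g = q ≫ τ ∧
        Resolution.IsBirational p.left ∧
        AlgebraicCycle.map q.left Order.height Order.height (Motives.primeCycle θ) = k • Motives.primeCycle ω := by
  intro n d e X V W hX hV hW hde g τ _ _ η ω hη hω z k hk hg hτ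
  obtain ⟨hgz, hτz, hsurj⟩ := stub_degreeFormula_h5pre hX hV hW g τ hη hω hk hg hτ
  obtain ⟨T, d', hT, p, q, hsq, hbir⟩ :=
    stub_degreeFormula_h5geom hX hV hW g τ hη hω (hgz.trans hτz.symm) hsurj
  exact stub_degreeFormula_h5deg hX hV hW hT hde g τ p q hη hω hk hg hτ hsq hbir

/-- The degree formula for the complex orientations from the wave-3 sub-stubs (closes the former `stub_degreeFormula`).
[cite: Fulton1998, Lemma 19.1.2] -/
theorem degreeFormula_of_stubs : Fulton1998_degreeFormula_complexOrientation :=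
  Fulton1998_degreeFormula_complexOrientation_of degreeFormula_h4_of_stubs degreeFormula_h5_of_stubs

/-! #### The spanning fact, cut into sub-stubs (lead c2)

Notation (all for `T` smooth projective of dimension `n`, `A : HodgeModel n T`): for a closed immersion
`Φ : T ⟶ ℙᴷ`, `c_Φ := A.chernCharacter (tautologicalBundle Φ A.isAnalytification) 1 ∈ H²(T(ℂ); ℂ)` — the first
Chern character of `𝒪(-1)|_T` in the embedding `Φ` (its Fubini–Study Chern connection is in the tree); for an
arbitrary morphism `ψ : T ⟶ ℙᴺ` and a Hodge model `B` of `ℙᴺ`, `c'_ψ := A.chernCharacter` of the PULL-BACK of the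
tautological cocycle of `ℙᴺ` along the analytic map `anMap B A ψ`. -/

/-- SUB-STUB A — LANDED p142281 (`HodgeModel.exists_chernCharacter_tautologicalBundle_pullback_eq_smul_map`): **functoriality of `ch₁(𝒪(-1))` along an arbitrary morphism `ψ : T ⟶ ℙᴺ`, up to
one non-zero scalar independent of `ψ`** (Chern–Weil: `chernCharacterDeRham_pullback`; comparison of the de Rham
families of the two Hodge models through `HodgeModel.inducedIso` and rigidity). [cite: Kobayashi1987, Ch. II §2 (2.10)] -/
theorem stub_chernCharacter_tautological_pullback :
    ∀ ⦃n N : ℕ⦄ ⦃T : Motives.SchemeOver ℂ⦄ (hT : Motives.IsSmoothProjective n T) (A : HodgeModel n T)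
      (B : HodgeModel N (Motives.projectiveSpace N ℂ))
      [IsClosedImmersion (𝟙 (Motives.projectiveSpace N ℂ) : Motives.projectiveSpace N ℂ ⟶ _).left], n ≤ N →
      ∃ r : ℂ, r ≠ 0 ∧ ∀ ψ : T ⟶ Motives.projectiveSpace N ℂ,
        A.chernCharacter
          ((Motives.AnalytificationKaehler.tautologicalBundle (𝟙 (Motives.projectiveSpace N ℂ)) B.isAnalytification).pullback
            (HodgeModel.anMap B A ψ)
            (HodgeModel.contMDiff_anMap B A ψ hT (isSmoothProjective_projectiveSpace' N))) 1 =
        r • complexBetti.map ψ (2 * 1)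
          (B.chernCharacter
            (Motives.AnalytificationKaehler.tautologicalBundle (𝟙 (Motives.projectiveSpace N ℂ)) B.isAnalytification) 1) :=
  HodgeModel.exists_chernCharacter_tautologicalBundle_pullback_eq_smul_map

/-- SUB-STUB C — LANDED p144320 (`HodgeModel.chernCharacter_tautologicalBundle_pullback_eq_smul_of_linEquiv`): **linear equivalence of hyperplane divisors transports to `ch₁`**:
if the pulled-back hyperplane divisor of a dominant `ψ : T ⟶ ℙᴺ` is linearly equivalent to `m` times the hyperplane
divisor of a closed immersion `Ψ : T ⟶ ℙᴷ`, then `c'_ψ = m • c_Ψ` (cocycles of linearly equivalent Cartier divisors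
are analytically equivalent; `CocycleIso.chernCharacterDeRham_eq`; `ch₁` of an `m`-th tensor power).
[cite: VoisinHodgeI2002, §11.1.2 and Thm. 11.33] [cite: GortzWedhorn2020, Def. 11.49] -/
theorem stub_chernCharacter_of_linEquiv :
    ∀ ⦃n N K : ℕ⦄ ⦃T : Motives.SchemeOver ℂ⦄ [IsIntegral T.left] (hT : Motives.IsSmoothProjective n T)
      (A : HodgeModel n T) (B : HodgeModel N (Motives.projectiveSpace N ℂ))
      [IsClosedImmersion (𝟙 (Motives.projectiveSpace N ℂ) : Motives.projectiveSpace N ℂ ⟶ _).left]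
      (Ψ : T ⟶ Motives.projectiveSpace K ℂ) [IsClosedImmersion Ψ.left]
      (ψ : T ⟶ Motives.projectiveSpace N ℂ) (hψ : IsDominant ψ.left) (j₀ : Fin (K + 1))
      (hj₀ : genericPoint T.left ∈ (Motives.GeneratingSections.ofHom Ψ.left).U j₀) (m : ℕ),
      (@Motives.CartierDivisor.pullback _ _ (Motives.ProjSpace.hyperplane N ℂ) T.left _ ψ.left hψ).LinEquiv
          (m • (Motives.GeneratingSections.ofHom Ψ.left).divisor j₀ hj₀) →
      A.chernCharacter
          ((Motives.AnalytificationKaehler.tautologicalBundle (𝟙 (Motives.projectiveSpace N ℂ)) B.isAnalytification).pullback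
            (HodgeModel.anMap B A ψ)
            (HodgeModel.contMDiff_anMap B A ψ hT (isSmoothProjective_projectiveSpace' N))) 1 =
        (m : ℂ) • A.chernCharacter (Motives.AnalytificationKaehler.tautologicalBundle Ψ A.isAnalytification) 1 :=
  HodgeModel.chernCharacter_tautologicalBundle_pullback_eq_smul_of_linEquiv

/-- SUB-STUB E1 — LANDED p142603 (`Motives.IsSmoothProjective.exists_isFinite_surjective_hyperplane_pullback_linEquiv`): **projective Noether normalisation with linear-equivalence control** for a smooth
projective `(d+1)`-fold embedded by `Ψ`: a finite surjective `ψ : T ⟶ ℙ^{d+1}` whose pulled-back hyperplane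
divisor is linearly equivalent to a positive multiple of the hyperplane divisor of `Ψ`
(`CartierDivisor.IsAmple.exists_finite_surjective_linEquiv`, `GeneratingSections.isAmple_divisor`, `schemeDim_eq_holds`).
[cite: GortzWedhorn2020, Thm. 13.89] -/
theorem stub_noether_linEquiv :
    ∀ ⦃d K : ℕ⦄ ⦃T : Motives.SchemeOver ℂ⦄ [IsIntegral T.left] (hT : Motives.IsSmoothProjective (d + 1) T)
      (Ψ : T ⟶ Motives.projectiveSpace K ℂ) [IsClosedImmersion Ψ.left] (j₀ : Fin (K + 1))
      (hj₀ : genericPoint T.left ∈ (Motives.GeneratingSections.ofHom Ψ.left).U j₀),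
      ∃ (ψ : T ⟶ Motives.projectiveSpace (d + 1) ℂ) (m : ℕ) (hψ : IsDominant ψ.left), 0 < m ∧
        IsFinite ψ.left ∧ Surjective ψ.left ∧
        (@Motives.CartierDivisor.pullback _ _ (Motives.ProjSpace.hyperplane (d + 1) ℂ) T.left _ ψ.left hψ).LinEquiv
          (m • (Motives.GeneratingSections.ofHom Ψ.left).divisor j₀ hj₀) :=
  Motives.IsSmoothProjective.exists_isFinite_surjective_hyperplane_pullback_linEquiv

/-- SUB-STUB P1 — LANDED p143563 (`HodgeModel.chernCharacter_tautologicalBundle_segre`): **Segre additivity of `ch₁(𝒪(-1))`**: for closed immersions `Φ₁ : T ⟶ ℙ^{K₁}`,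
`Φ₂ : T ⟶ ℙ^{K₂}`, the Segre embedding of `(Φ₁, Φ₂)` has `c = c_{Φ₁} + c_{Φ₂}` (its tautological cocycle is the
tensor product of the two; Chern–Weil for a product connection on line cocycles).
[cite: Hartshorne1977, II Ex. 5.11 and Ex. 5.12] [cite: Kobayashi1987, Ch. II §1 (1.9)] -/
theorem stub_chernCharacter_tautological_segre :
    ∀ ⦃n K₁ K₂ : ℕ⦄ ⦃T : Motives.SchemeOver ℂ⦄ (_hT : Motives.IsSmoothProjective n T) (A : HodgeModel n T)
      (Φ₁ : T ⟶ Motives.projectiveSpace K₁ ℂ) [IsClosedImmersion Φ₁.left]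
      (Φ₂ : T ⟶ Motives.projectiveSpace K₂ ℂ) [IsClosedImmersion Φ₂.left]
      [IsClosedImmersion (CartesianMonoidalCategory.lift Φ₁ Φ₂ ≫ Motives.segreEmbedding K₁ K₂ ℂ).left],
      A.chernCharacter (Motives.AnalytificationKaehler.tautologicalBundle
          (CartesianMonoidalCategory.lift Φ₁ Φ₂ ≫ Motives.segreEmbedding K₁ K₂ ℂ) A.isAnalytification) 1 =
        A.chernCharacter (Motives.AnalytificationKaehler.tautologicalBundle Φ₁ A.isAnalytification) 1 +
          A.chernCharacter (Motives.AnalytificationKaehler.tautologicalBundle Φ₂ A.isAnalytification) 1 :=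
  HodgeModel.chernCharacter_tautologicalBundle_segre

/-- SUB-STUB G4a — LANDED (`Motives.CartierDivisor.effectiveCartier_linEquiv_hyperplanePullbacks`, module
`Motives/EffectiveCartierSerreA`): **Serre's theorem A for the ideal sheaf of an effective Cartier
divisor, in divisor form**: for `E` effective on the smooth projective `T`, embedded by the closed immersion `ι : T ⟶ ℙᴺ`
with hyperplane divisor `H_ι`, there are `m`, a morphism `F : T ⟶ ℙᴹ` and a hyperplane divisor `D_F` of `F` with
`E + D_F ∼ m • H_ι` (the generators `g_k` of `I_E(m)` define `F`; `E + D_{F,k₀}` has local equation `g_{k₀}/x_a^m`).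
[cite: Hartshorne1977, II Thm. 5.17 and II Thm. 7.1] -/
theorem stub_effectiveCartier_linEquiv_hyperplanePullbacks :
    ∀ ⦃n N : ℕ⦄ ⦃T : Motives.SchemeOver ℂ⦄ [IsIntegral T.left] (_hT : Motives.IsSmoothProjective n T)
      (ι : T ⟶ Motives.projectiveSpace N ℂ) [IsClosedImmersion ι.left] (j₀ : Fin (N + 1))
      (hj₀ : genericPoint T.left ∈ (Motives.GeneratingSections.ofHom ι.left).U j₀)
      (E : Motives.CartierDivisor T.left), E.IsEffective →
      ∃ (m M : ℕ) (F : T ⟶ Motives.projectiveSpace M ℂ) (k₀ : Fin (M + 1))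
        (hk₀ : genericPoint T.left ∈ (Motives.GeneratingSections.ofHom F.left).U k₀),
        (E + (Motives.GeneratingSections.ofHom F.left).divisor k₀ hk₀).LinEquiv
          (m • (Motives.GeneratingSections.ofHom ι.left).divisor j₀ hj₀) :=
  Motives.CartierDivisor.effectiveCartier_linEquiv_hyperplanePullbacks

/-- SUB-STUB G4b — LANDED p144678 (`lefschetzOneOne_tautological_of_serreA`, module `LefschetzOneOneEmbeddingCurrency`; toolkit p144584
`CartierCocycleChernCalculus`): **Lefschetz `(1,1)` in embedding currency from G4a** — a rational
`(1,1)`-class is `a • ch₁(𝒪_T(D)^an)` for one Cartier `D` (LANDED p143331,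
`exists_eq_smul_chernCharacter_cartierDivisorCocycle`); `D + m₁H_ι` has a non-zero section
(`CartierDivisor.exists_isSection_add_smul_of_isAffineOpen`), so `D ∼ E − m₁H_ι` with `E` effective; G4a gives
`E + D_F ∼ m H_ι`; `ch₁(𝒪(·)^an)` is additive and invariant under linear equivalence, `ch₁(𝒪(H_Ψ)^an) = −c_Ψ` for a
closed immersion `Ψ`, and `D_F + H_ι ∼ H_{σ∘(ι,F)}` (Segre), so the class lies in `span{c_ι, c_{σ∘(ι,F)}}`.
[cite: VoisinHodgeI2002, Thm. 11.30 and Thm. 11.33] [cite: Hartshorne1977, II Ex. 5.12] -/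
theorem stub_lefschetzOneOne_tautological_of_serreA :
    (∀ ⦃n N : ℕ⦄ ⦃T : Motives.SchemeOver ℂ⦄ [IsIntegral T.left] (_hT : Motives.IsSmoothProjective n T)
      (ι : T ⟶ Motives.projectiveSpace N ℂ) [IsClosedImmersion ι.left] (j₀ : Fin (N + 1))
      (hj₀ : genericPoint T.left ∈ (Motives.GeneratingSections.ofHom ι.left).U j₀)
      (E : Motives.CartierDivisor T.left), E.IsEffective →
      ∃ (m M : ℕ) (F : T ⟶ Motives.projectiveSpace M ℂ) (k₀ : Fin (M + 1))
        (hk₀ : genericPoint T.left ∈ (Motives.GeneratingSections.ofHom F.left).U k₀),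
        (E + (Motives.GeneratingSections.ofHom F.left).divisor k₀ hk₀).LinEquiv
          (m • (Motives.GeneratingSections.ofHom ι.left).divisor j₀ hj₀)) →
    ∀ ⦃n : ℕ⦄ ⦃T : Motives.SchemeOver ℂ⦄ (_hT : Motives.IsSmoothProjective n T) (A : HodgeModel n T), 1 ≤ n →
      ∀ y : complexBetti T (2 * 1), IsRationalClass y → IsOfHodgeType n T (2 * 1) 1 1 y →
        y ∈ Submodule.span ℂ {c : complexBetti T (2 * 1) |
          ∃ (K : ℕ) (Φ : T ⟶ Motives.projectiveSpace K ℂ) (_ : IsClosedImmersion Φ.left),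
            c = A.chernCharacter (Motives.AnalytificationKaehler.tautologicalBundle Φ A.isAnalytification) 1}  :=
  lefschetzOneOne_tautological_of_serreA

/-- SUB-STUB G4 (the Lefschetz theorem on `(1,1)`-classes in EMBEDDING CURRENCY), now DERIVED from G4a and G4b:
every rational `(1,1)`-class of a smooth projective `T` of dimension `n ≥ 1` is a `ℂ`-combination of the classes
`c_Φ` of closed immersions `Φ : T ⟶ ℙᴷ`. [cite: VoisinHodgeI2002, Thm. 11.30 and Thm. 11.33]
[cite: Hartshorne1977, II Thm. 5.17 and II Thm. 7.6] -/
theorem lefschetzOneOne_tautological_of_stubs :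
    ∀ ⦃n : ℕ⦄ ⦃T : Motives.SchemeOver ℂ⦄ (_hT : Motives.IsSmoothProjective n T) (A : HodgeModel n T), 1 ≤ n →
      ∀ y : complexBetti T (2 * 1), IsRationalClass y → IsOfHodgeType n T (2 * 1) 1 1 y →
        y ∈ Submodule.span ℂ {c : complexBetti T (2 * 1) |
          ∃ (K : ℕ) (Φ : T ⟶ Motives.projectiveSpace K ℂ) (_ : IsClosedImmersion Φ.left),
            c = A.chernCharacter (Motives.AnalytificationKaehler.tautologicalBundle Φ A.isAnalytification) 1}  :=
  stub_lefschetzOneOne_tautological_of_serreA stub_effectiveCartier_linEquiv_hyperplanePullbacks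

/-- SUB-STUB (assembly) — LANDED p142979 (`topHodgeClasses_spanned_by_pullbacks_of_inputs`, with p142532
`LefschetzPowerPolarisation`): **the five sub-stubs A, C, E1, P1, G4 imply the spanning fact** — hard
Lefschetz with surjectivity on rational Hodge classes (`nonempty_hardLefschetzNFold_holds`, `exists_hdg_preimage`,
hyperplane class `∝ ι^* g_N ∝ c_ι`), polarisation of `c_ι^{d-1} ∪ c_Φ` into `d`-th powers of `c_ι + t c_Φ = c_{Ψ_t}`
(P1, Segre iteration), and `c_{Ψ_t}^d ∝ ψ_t^*(g^d)` for the Noether map `ψ_t : T ⟶ ℙ^{d+1}` (E1 + C + A).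
[cite: VoisinHodgeI2002, Thm. 6.25 and Thm. 11.30] [cite: GortzWedhorn2020, Thm. 13.89] -/
theorem stub_spanningAssembly :
    (∀ ⦃n N : ℕ⦄ ⦃T : Motives.SchemeOver ℂ⦄ (hT : Motives.IsSmoothProjective n T) (A : HodgeModel n T)
      (B : HodgeModel N (Motives.projectiveSpace N ℂ))
      [IsClosedImmersion (𝟙 (Motives.projectiveSpace N ℂ) : Motives.projectiveSpace N ℂ ⟶ _).left], n ≤ N →
      ∃ r : ℂ, r ≠ 0 ∧ ∀ ψ : T ⟶ Motives.projectiveSpace N ℂ,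
        A.chernCharacter
          ((Motives.AnalytificationKaehler.tautologicalBundle (𝟙 (Motives.projectiveSpace N ℂ)) B.isAnalytification).pullback
            (HodgeModel.anMap B A ψ)
            (HodgeModel.contMDiff_anMap B A ψ hT (isSmoothProjective_projectiveSpace' N))) 1 =
        r • complexBetti.map ψ (2 * 1)
          (B.chernCharacter
            (Motives.AnalytificationKaehler.tautologicalBundle (𝟙 (Motives.projectiveSpace N ℂ)) B.isAnalytification) 1)) →
    (∀ ⦃n N K : ℕ⦄ ⦃T : Motives.SchemeOver ℂ⦄ [IsIntegral T.left] (hT : Motives.IsSmoothProjective n T)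
      (A : HodgeModel n T) (B : HodgeModel N (Motives.projectiveSpace N ℂ))
      [IsClosedImmersion (𝟙 (Motives.projectiveSpace N ℂ) : Motives.projectiveSpace N ℂ ⟶ _).left]
      (Ψ : T ⟶ Motives.projectiveSpace K ℂ) [IsClosedImmersion Ψ.left]
      (ψ : T ⟶ Motives.projectiveSpace N ℂ) (hψ : IsDominant ψ.left) (j₀ : Fin (K + 1))
      (hj₀ : genericPoint T.left ∈ (Motives.GeneratingSections.ofHom Ψ.left).U j₀) (m : ℕ),
      (@Motives.CartierDivisor.pullback _ _ (Motives.ProjSpace.hyperplane N ℂ) T.left _ ψ.left hψ).LinEquiv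
          (m • (Motives.GeneratingSections.ofHom Ψ.left).divisor j₀ hj₀) →
      A.chernCharacter
          ((Motives.AnalytificationKaehler.tautologicalBundle (𝟙 (Motives.projectiveSpace N ℂ)) B.isAnalytification).pullback
            (HodgeModel.anMap B A ψ)
            (HodgeModel.contMDiff_anMap B A ψ hT (isSmoothProjective_projectiveSpace' N))) 1 =
        (m : ℂ) • A.chernCharacter (Motives.AnalytificationKaehler.tautologicalBundle Ψ A.isAnalytification) 1) →
    (∀ ⦃d K : ℕ⦄ ⦃T : Motives.SchemeOver ℂ⦄ [IsIntegral T.left] (hT : Motives.IsSmoothProjective (d + 1) T)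
      (Ψ : T ⟶ Motives.projectiveSpace K ℂ) [IsClosedImmersion Ψ.left] (j₀ : Fin (K + 1))
      (hj₀ : genericPoint T.left ∈ (Motives.GeneratingSections.ofHom Ψ.left).U j₀),
      ∃ (ψ : T ⟶ Motives.projectiveSpace (d + 1) ℂ) (m : ℕ) (hψ : IsDominant ψ.left), 0 < m ∧
        IsFinite ψ.left ∧ Surjective ψ.left ∧
        (@Motives.CartierDivisor.pullback _ _ (Motives.ProjSpace.hyperplane (d + 1) ℂ) T.left _ ψ.left hψ).LinEquiv
          (m • (Motives.GeneratingSections.ofHom Ψ.left).divisor j₀ hj₀)) →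
    (∀ ⦃n K₁ K₂ : ℕ⦄ ⦃T : Motives.SchemeOver ℂ⦄ (_hT : Motives.IsSmoothProjective n T) (A : HodgeModel n T)
      (Φ₁ : T ⟶ Motives.projectiveSpace K₁ ℂ) [IsClosedImmersion Φ₁.left]
      (Φ₂ : T ⟶ Motives.projectiveSpace K₂ ℂ) [IsClosedImmersion Φ₂.left]
      [IsClosedImmersion (CartesianMonoidalCategory.lift Φ₁ Φ₂ ≫ Motives.segreEmbedding K₁ K₂ ℂ).left],
      A.chernCharacter (Motives.AnalytificationKaehler.tautologicalBundle
          (CartesianMonoidalCategory.lift Φ₁ Φ₂ ≫ Motives.segreEmbedding K₁ K₂ ℂ) A.isAnalytification) 1 =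
        A.chernCharacter (Motives.AnalytificationKaehler.tautologicalBundle Φ₁ A.isAnalytification) 1 +
          A.chernCharacter (Motives.AnalytificationKaehler.tautologicalBundle Φ₂ A.isAnalytification) 1) →
    (∀ ⦃n : ℕ⦄ ⦃T : Motives.SchemeOver ℂ⦄ (_hT : Motives.IsSmoothProjective n T) (A : HodgeModel n T), 1 ≤ n →
      ∀ y : complexBetti T (2 * 1), IsRationalClass y → IsOfHodgeType n T (2 * 1) 1 1 y →
        y ∈ Submodule.span ℂ {c : complexBetti T (2 * 1) |
          ∃ (K : ℕ) (Φ : T ⟶ Motives.projectiveSpace K ℂ) (_ : IsClosedImmersion Φ.left),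
            c = A.chernCharacter (Motives.AnalytificationKaehler.tautologicalBundle Φ A.isAnalytification) 1}) →
    topHodgeClasses_spanned_by_pullbacks :=
  topHodgeClasses_spanned_by_pullbacks_of_inputs

/-- The spanning fact (the catalogued named debt `topHodgeClasses_spanned_by_pullbacks`, which with the degree
formula yields Voisin II Lemma 9.18, `Voisin2003_cycleClass_div_eq_zero_complexOrientation_of_degreeFormula_of_spanning`)
from the six sub-stubs. [cite: VoisinHodgeI2002, Thm. 6.25 and Thm. 11.30] -/
theorem topHodgeClassesSpannedByPullbacks_of_stubs : topHodgeClasses_spanned_by_pullbacks :=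
  stub_spanningAssembly stub_chernCharacter_tautological_pullback stub_chernCharacter_of_linEquiv
    stub_noether_linEquiv stub_chernCharacter_tautological_segre lefschetzOneOne_tautological_of_stubs

/-- Lead c1's second stub, now DERIVED: the degree formula and the spanning fact give Lemma 9.18 for the complex
orientations (the tree's `Voisin2003_cycleClass_div_eq_zero_complexOrientation_of_degreeFormula_of_spanning`).
[cite: VoisinHodgeII2003, Lemma 9.18] -/
theorem cycleClassDivEqZero_of_degreeFormula :
    Fulton1998_degreeFormula_complexOrientation → Voisin2003_cycleClass_div_eq_zero_complexOrientation :=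
  fun hB ↦ Voisin2003_cycleClass_div_eq_zero_complexOrientation_of_degreeFormula_of_spanning hB
    topHodgeClassesSpannedByPullbacks_of_stubs

/-- STUB 3 (THE HEART): the middle step for CH₀-non-degenerate `2q`-folds — necessary for the crux
(`verticalSupportMiddle_iff_regimes`) and, with the landed regime, sufficient; summit-sized by
`verticalSupportMiddle_iff_hodgeConjecture`. Not attacked by this line. -/
theorem stub_middleStepHeartland : MiddleStepFor fun X ↦ ¬ ChowZeroDegenerate X := by
  sorry

/-! ### The composition -/

/-- **THE LINE'S COMPOSITION: the three open stubs → the crux `VerticalSupportMiddle` BY NAME**, through the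
landed `Voisin2003_cycleClass_div_eq_zero_complexOrientation_of_degreeFormula_of_spanning`,
`middleStepChowDegenerate_of_complexOrientationFacts` and `verticalSupportMiddle_of_regimes`. [folklore] -/
theorem VerticalSupportMiddle_of :
    Fulton1998_degreeFormula_complexOrientation →
    topHodgeClasses_spanned_by_pullbacks →
    (MiddleStepFor fun X ↦ ¬ ChowZeroDegenerate X) →
    Summit.HodgeConjecture.HodgeConjecture.Theses.CurveNetMordellWeil.VerticalSupportMiddle :=
  fun hB hS hH ↦ verticalSupportMiddle_of_regimes hH (middleStepChowDegenerate_of_complexOrientationFacts hB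
    (Voisin2003_cycleClass_div_eq_zero_complexOrientation_of_degreeFormula_of_spanning hB hS))

/-- The crux, closed modulo exactly the three open stubs. -/
theorem VerticalSupportMiddle_of_stubs :
    Summit.HodgeConjecture.HodgeConjecture.Theses.CurveNetMordellWeil.VerticalSupportMiddle :=
  VerticalSupportMiddle_of degreeFormula_of_stubs topHodgeClassesSpannedByPullbacks_of_stubs stub_middleStepHeartland

/-- Sanity / necessity: the crux implies every stub's conclusion except the two Gysin facts (which it does not
need to: they are theorems in print) — in particular the heart. [folklore] -/
theorem heart_of_verticalSupportMiddle
    (h : Summit.HodgeConjecture.HodgeConjecture.Theses.CurveNetMordellWeil.VerticalSupportMiddle) :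
    MiddleStepFor fun X ↦ ¬ ChowZeroDegenerate X :=
  (verticalSupportMiddle_iff_regimes.1 h).1

end Summit.HodgeConjecture.HodgeConjecture.Cruxes.VerticalSupportMiddle.RegimeSplitMiddleStep

end
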